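import Summits.ABC.ABC.Theorems.CongruentialReceptacleTameLocalReceptacleFamilyCounts
import Literature.NumberTheory.Sieve.SmoothParityTernary

/-!
# Crux `TameLocalReceptacle` (stmt-ABC-14354), line `grh-friable-cell-resolution`:
# the Bonferroni lower bound for `#FCfam` by parity ternary counts

Registered stub `stub_cardFC_ge_bonferroni` of the checked skeleton
`Cruxes/TameLocalReceptacle/Lines/grh_friable_cell_resolution.lean` (lead `prover-line-stmt-ABC-14354-a1-0`, wave 7):
with `W(X₁, X₂, X₃) := parityTernarySum y (−1) 2^N 1 X₁ X₂ X₃ c₁ c₂ c₃`, the weighted count of `y`-friable solutions of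
`2^N m − a = b`, `m ≤ X₁` odd, `a ≤ X₂` odd, `b ≤ X₃` free, with REAL nonnegative profile weights
`p₁ ≤ 1_{(1/2,1]}`, `p₂ ≤ 1_{(1/2,3/4]}`, `p₃ ≤ 1`,

`Re W(4M, 2X, 4X) − Σ_{3 ≤ p ≤ y prime} Re W(4M/p, 2X/p, 4X/p) ≤ #FCfam N M y`     (`X = 2^N M`).

Proof (pure `Finset` combinatorics + a Bonferroni inequality), everything written as single sums over the index triples
`T(X₁,X₂,X₃) = S(X₁)_odd × S(X₂)_odd × S(X₃)` (`S(Z) = Nat.smoothNumbersUpTo ⌊Z⌋₊ (y+1)`):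
* realness: `Re (p₁ p₂ conj p₃) = Re p₁ Re p₂ Re p₃ =: g ≥ 0` (`re_parityTernarySum`);
* SUBLATTICE IDENTITY (`parityTernarySum_div_eq`): for `p` odd and `y`-friable, `W(X₁/p, X₂/p, X₃/p)` is the part of the
  triple sum at scales `X_i` supported on triples of multiples of `p` — substitute `n_i = p n_i'`
  (`p n' ≤ ⌊X⌋₊ ⟺ n' ≤ ⌊X/p⌋₊`, friability/oddness and the equation are invariant, `p_c(n'/(X/p)) = p_c(p n'/X)`);
* POINTWISE BONFERRONI (`ite_sub_sum_le`, `pointwise_FC`): `1_E g (1 − Σ_p 1_{p ∣ m, a, b}) ≤ 1_{E ∧ gcd(m,a)=1 ∧ ranges}`: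
  if `gcd(m, a) > 1` it has a prime factor `p`, odd (`m` odd), `≤ y` (`m` friable), dividing `b = 2^N m − a`; otherwise
  `g ≤ 1_{m/4M ∈ (1/2,1]} 1_{a/2X ∈ (1/2,3/4]} = 1_{2M < m ≤ 4M} 1_{X < a, 2a ≤ 3X}`;
* COUNTING (`card_filter_le_card_FCfam`): the triples with `E ∧ gcd(m,a) = 1 ∧ ranges` inject by `(m, a, b) ↦ (m, a)` into
  the pair set of `card_FCfam` (`gcd(a, 2m) = 1 ⟸ a` odd `∧ gcd(m,a) = 1`; `2^N m − a = b` friable; `a ≤ 3X/2 ⟸ 2a ≤ 3X`).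
The hypothesis `2 ≤ y` of the registered signature is not needed.
-/

-- `Summit.<Summit>.<Problem>` is the mandated summit-side namespace (CONVENTIONS §2); for the
-- single-conjunct summit `ABC` the two coincide, so the duplicate `ABC.ABC` is deliberate.
set_option linter.dupNamespace false

noncomputable section

namespace Summit.ABC.ABC.Theorems.TameLocalReceptacle

open Finset Literature.NumberTheory.Sieve.SmoothArcs

namespace BonferroniFCBook

/-! ### Multiples of `p` among friable integers: the sublattice bijection -/

/-- The multiples of `p` among the `y`-friable `n ≤ ⌊Z⌋₊` are exactly the `p n'`, `n'` `y`-friable `≤ ⌊Z/p⌋₊`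
(`p ≠ 0` itself `y`-friable). [folklore] -/
theorem filter_dvd_smoothNumbersUpTo {y p : ℕ} (hp : p ≠ 0) (hps : p ∈ Nat.smoothNumbers (y + 1)) (Z : ℝ) :
    (Nat.smoothNumbersUpTo ⌊Z⌋₊ (y + 1)).filter (fun n => p ∣ n) =
      (Nat.smoothNumbersUpTo ⌊Z / p⌋₊ (y + 1)).image (fun n => p * n) := by
  ext n
  simp only [Finset.mem_filter, Finset.mem_image, Nat.mem_smoothNumbersUpTo, Nat.floor_div_natCast,
    Nat.le_div_iff_mul_le (Nat.pos_of_ne_zero hp)]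
  constructor
  · rintro ⟨⟨hn, hns⟩, k, rfl⟩
    exact ⟨k, ⟨by rwa [mul_comm] at hn, Nat.mem_smoothNumbers_of_dvd hns (dvd_mul_left k p)⟩, rfl⟩
  · rintro ⟨k, ⟨hk, hks⟩, rfl⟩
    exact ⟨⟨by rwa [mul_comm] at hk, Nat.mul_mem_smoothNumbers hps hks⟩, dvd_mul_right p k⟩

/-- The same among the ODD `y`-friable `n ≤ ⌊Z⌋₊`, for `p` odd and `y`-friable. [folklore] -/
theorem filter_dvd_smoothNumbersUpTo_odd {y p : ℕ} (hp : Odd p) (hps : p ∈ Nat.smoothNumbers (y + 1)) (Z : ℝ) :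
    ((Nat.smoothNumbersUpTo ⌊Z⌋₊ (y + 1)).filter (fun n => Odd n)).filter (fun n => p ∣ n) =
      ((Nat.smoothNumbersUpTo ⌊Z / p⌋₊ (y + 1)).filter (fun n => Odd n)).image (fun n => p * n) := by
  ext n
  simp only [Finset.mem_filter, Finset.mem_image, Nat.mem_smoothNumbersUpTo, Nat.floor_div_natCast,
    Nat.le_div_iff_mul_le hp.pos]
  constructor
  · rintro ⟨⟨⟨hn, hns⟩, hno⟩, k, rfl⟩
    exact ⟨k, ⟨⟨by rwa [mul_comm] at hn, Nat.mem_smoothNumbers_of_dvd hns (dvd_mul_left k p)⟩,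
      (Nat.odd_mul.1 hno).2⟩, rfl⟩
  · rintro ⟨k, ⟨⟨hk, hks⟩, hko⟩, rfl⟩
    exact ⟨⟨⟨by rwa [mul_comm] at hk, Nat.mul_mem_smoothNumbers hps hks⟩, Nat.odd_mul.2 ⟨hp, hko⟩⟩,
      dvd_mul_right p k⟩

/-- Scaling by `p` (odd, `y`-friable) is a bijection from the index triples `S(X₁/p)_odd × S(X₂/p)_odd × S(X₃/p)` onto
the index triples at scales `X_i` all of whose entries are multiples of `p`. [folklore] -/
theorem filter_dvd_triples {y p : ℕ} (hp : Odd p) (hps : p ∈ Nat.smoothNumbers (y + 1)) (X₁ X₂ X₃ : ℝ) :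
    (((Nat.smoothNumbersUpTo ⌊X₁⌋₊ (y + 1)).filter (fun n => Odd n)) ×ˢ
        (((Nat.smoothNumbersUpTo ⌊X₂⌋₊ (y + 1)).filter (fun n => Odd n)) ×ˢ
          Nat.smoothNumbersUpTo ⌊X₃⌋₊ (y + 1))).filter (fun t => p ∣ t.1 ∧ p ∣ t.2.1 ∧ p ∣ t.2.2) =
      (((Nat.smoothNumbersUpTo ⌊X₁ / p⌋₊ (y + 1)).filter (fun n => Odd n)) ×ˢ
        (((Nat.smoothNumbersUpTo ⌊X₂ / p⌋₊ (y + 1)).filter (fun n => Odd n)) ×ˢ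
          Nat.smoothNumbersUpTo ⌊X₃ / p⌋₊ (y + 1))).image (fun t => (p * t.1, p * t.2.1, p * t.2.2)) := by
  ext ⟨n₁, n₂, n₃⟩
  have e₁ := Finset.ext_iff.1 (filter_dvd_smoothNumbersUpTo_odd hp hps X₁) n₁
  have e₂ := Finset.ext_iff.1 (filter_dvd_smoothNumbersUpTo_odd hp hps X₂) n₂
  have e₃ := Finset.ext_iff.1 (filter_dvd_smoothNumbersUpTo hp.pos.ne' hps X₃) n₃
  simp only [Finset.mem_filter, Finset.mem_image] at e₁ e₂ e₃
  simp only [Finset.mem_filter, Finset.mem_image, Finset.mem_product, Prod.mk.injEq, Prod.exists]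
  constructor
  · rintro ⟨⟨h₁, h₂, h₃⟩, d₁, d₂, d₃⟩
    obtain ⟨k₁, hk₁, rfl⟩ := e₁.1 ⟨h₁, d₁⟩
    obtain ⟨k₂, hk₂, rfl⟩ := e₂.1 ⟨h₂, d₂⟩
    obtain ⟨k₃, hk₃, rfl⟩ := e₃.1 ⟨h₃, d₃⟩
    exact ⟨k₁, k₂, k₃, ⟨hk₁, hk₂, hk₃⟩, rfl, rfl, rfl⟩
  · rintro ⟨k₁, k₂, k₃, ⟨hk₁, hk₂, hk₃⟩, rfl, rfl, rfl⟩
    obtain ⟨h₁, d₁⟩ := e₁.2 ⟨k₁, hk₁, rfl⟩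
    obtain ⟨h₂, d₂⟩ := e₂.2 ⟨k₂, hk₂, rfl⟩
    obtain ⟨h₃, d₃⟩ := e₃.2 ⟨k₃, hk₃, rfl⟩
    exact ⟨⟨h₁, h₂, h₃⟩, d₁, d₂, d₃⟩

/-- Reindexing: a sum over the index triples at scales `X_i/p` of `F(p t)` is the sum of `F` over the `p`-divisible index
triples at scales `X_i`. [folklore] -/
theorem sum_triples_div {y p : ℕ} (hp : Odd p) (hps : p ∈ Nat.smoothNumbers (y + 1)) (X₁ X₂ X₃ : ℝ)
    (F : ℕ × ℕ × ℕ → ℂ) :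
    ∑ t ∈ ((Nat.smoothNumbersUpTo ⌊X₁ / p⌋₊ (y + 1)).filter (fun n => Odd n)) ×ˢ
        (((Nat.smoothNumbersUpTo ⌊X₂ / p⌋₊ (y + 1)).filter (fun n => Odd n)) ×ˢ
          Nat.smoothNumbersUpTo ⌊X₃ / p⌋₊ (y + 1)), F (p * t.1, p * t.2.1, p * t.2.2) =
      ∑ t ∈ ((Nat.smoothNumbersUpTo ⌊X₁⌋₊ (y + 1)).filter (fun n => Odd n)) ×ˢ
        (((Nat.smoothNumbersUpTo ⌊X₂⌋₊ (y + 1)).filter (fun n => Odd n)) ×ˢ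
          Nat.smoothNumbersUpTo ⌊X₃⌋₊ (y + 1)), if p ∣ t.1 ∧ p ∣ t.2.1 ∧ p ∣ t.2.2 then F t else 0 := by
  rw [← Finset.sum_filter, filter_dvd_triples hp hps, Finset.sum_image]
  rintro ⟨a, b, c⟩ _ ⟨a', b', c'⟩ _ h
  simp only [Prod.mk.injEq] at h ⊢
  exact ⟨Nat.eq_of_mul_eq_mul_left hp.pos h.1, Nat.eq_of_mul_eq_mul_left hp.pos h.2.1,
    Nat.eq_of_mul_eq_mul_left hp.pos h.2.2⟩

/-! ### The parity ternary count over index triples; the sublattice identity; real parts -/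

/-- `parityTernarySum` as a single sum over the index triples `S(X₁)_odd × S(X₂)_odd × S(X₃)`. [folklore] -/
theorem parityTernarySum_eq_sum_triples (y : ℕ) (σ : ℤ) (d₁ d₂ : ℕ) (X₁ X₂ X₃ : ℝ) (c₁ c₂ c₃ : ℤ → ℂ) :
    parityTernarySum y σ d₁ d₂ X₁ X₂ X₃ c₁ c₂ c₃ =
      ∑ t ∈ ((Nat.smoothNumbersUpTo ⌊X₁⌋₊ (y + 1)).filter (fun n => Odd n)) ×ˢ
        (((Nat.smoothNumbersUpTo ⌊X₂⌋₊ (y + 1)).filter (fun n => Odd n)) ×ˢ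
          Nat.smoothNumbersUpTo ⌊X₃⌋₊ (y + 1)),
        if (d₁ * t.1 : ℤ) + σ * (d₂ * t.2.1) = t.2.2 then
          profileFn c₁ ((t.1 : ℝ) / X₁) * profileFn c₂ ((t.2.1 : ℝ) / X₂) *
            starRingEnd ℂ (profileFn c₃ ((t.2.2 : ℝ) / X₃))
        else 0 := by
  simp only [parityTernarySum, Finset.sum_product]

/-- **Sublattice identity.** For `p` odd and `y`-friable, the count at scales `X_i/p` is the part of the count at scales
`X_i`, written over the index triples, supported on the triples of multiples of `p`: substitute `n_i = p n_i'`
(`p n' ≤ ⌊X⌋₊ ⟺ n' ≤ ⌊X/p⌋₊`; `p n'` is friable, resp. odd, iff `n'` is; the equation `d₁n₁ + σ d₂n₂ = n₃` and the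
weights `p_c(n'/(X/p)) = p_c(p n'/X)` are invariant). [folklore] -/
theorem parityTernarySum_div_eq {y p : ℕ} (hp : Odd p) (hps : p ∈ Nat.smoothNumbers (y + 1)) (σ : ℤ) (d₁ d₂ : ℕ)
    (X₁ X₂ X₃ : ℝ) (c₁ c₂ c₃ : ℤ → ℂ) :
    parityTernarySum y σ d₁ d₂ (X₁ / p) (X₂ / p) (X₃ / p) c₁ c₂ c₃ =
      ∑ t ∈ ((Nat.smoothNumbersUpTo ⌊X₁⌋₊ (y + 1)).filter (fun n => Odd n)) ×ˢ
        (((Nat.smoothNumbersUpTo ⌊X₂⌋₊ (y + 1)).filter (fun n => Odd n)) ×ˢ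
          Nat.smoothNumbersUpTo ⌊X₃⌋₊ (y + 1)),
        if p ∣ t.1 ∧ p ∣ t.2.1 ∧ p ∣ t.2.2 then
          (if (d₁ * t.1 : ℤ) + σ * (d₂ * t.2.1) = t.2.2 then
            profileFn c₁ ((t.1 : ℝ) / X₁) * profileFn c₂ ((t.2.1 : ℝ) / X₂) *
              starRingEnd ℂ (profileFn c₃ ((t.2.2 : ℝ) / X₃))
          else 0)
        else 0 := by
  rw [parityTernarySum_eq_sum_triples]
  refine Eq.trans (Finset.sum_congr rfl fun t _ => ?_)
    (sum_triples_div hp hps X₁ X₂ X₃ (fun t => if (d₁ * t.1 : ℤ) + σ * (d₂ * t.2.1) = t.2.2 then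
      profileFn c₁ ((t.1 : ℝ) / X₁) * profileFn c₂ ((t.2.1 : ℝ) / X₂) *
        starRingEnd ℂ (profileFn c₃ ((t.2.2 : ℝ) / X₃)) else 0))
  have hp0 : (p : ℤ) ≠ 0 := by exact_mod_cast hp.pos.ne'
  have hw : ∀ (n : ℕ) (X : ℝ), ((p * n : ℕ) : ℝ) / X = (n : ℝ) / (X / p) := fun n X => by
    rw [Nat.cast_mul, div_div_eq_mul_div, mul_comm]
  dsimp only
  rw [hw, hw, hw]
  refine if_congr ⟨fun h => ?_, fun h => ?_⟩ rfl rfl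
  · push_cast
    linear_combination (p : ℤ) * h
  · refine mul_left_cancel₀ hp0 ?_
    push_cast at h
    linear_combination h

/-- A product `z₁ z₂ conj z₃` with `z₁, z₂` real has real part `Re z₁ Re z₂ Re z₃`. [folklore] -/
theorem re_mul_mul_conj {z₁ z₂ : ℂ} (h₁ : z₁.im = 0) (h₂ : z₂.im = 0) (z₃ : ℂ) :
    (z₁ * z₂ * starRingEnd ℂ z₃).re = z₁.re * z₂.re * z₃.re := by
  simp [Complex.mul_re, Complex.mul_im, h₁, h₂]

/-- With real profiles `p₁, p₂`, the real part of the count is the triple sum of the real weights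
`1_E · Re p₁ Re p₂ Re p₃`. [folklore] -/
theorem re_parityTernarySum {c₁ c₂ : ℤ → ℂ} (h₁ : ∀ v : ℝ, (profileFn c₁ v).im = 0)
    (h₂ : ∀ v : ℝ, (profileFn c₂ v).im = 0) (y : ℕ) (σ : ℤ) (d₁ d₂ : ℕ) (X₁ X₂ X₃ : ℝ) (c₃ : ℤ → ℂ) :
    (parityTernarySum y σ d₁ d₂ X₁ X₂ X₃ c₁ c₂ c₃).re =
      ∑ t ∈ ((Nat.smoothNumbersUpTo ⌊X₁⌋₊ (y + 1)).filter (fun n => Odd n)) ×ˢ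
        (((Nat.smoothNumbersUpTo ⌊X₂⌋₊ (y + 1)).filter (fun n => Odd n)) ×ˢ
          Nat.smoothNumbersUpTo ⌊X₃⌋₊ (y + 1)),
        if (d₁ * t.1 : ℤ) + σ * (d₂ * t.2.1) = t.2.2 then
          (profileFn c₁ ((t.1 : ℝ) / X₁)).re * (profileFn c₂ ((t.2.1 : ℝ) / X₂)).re *
            (profileFn c₃ ((t.2.2 : ℝ) / X₃)).re
        else 0 := by
  rw [parityTernarySum_eq_sum_triples, Complex.re_sum]
  refine Finset.sum_congr rfl fun t _ => ?_
  split_ifs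
  · exact re_mul_mul_conj (h₁ _) (h₂ _) _
  · exact Complex.zero_re

/-- With real profiles, the real part of the count at scales `X_i/p` (`p` odd, `y`-friable) is the triple sum of the
real weights over the `p`-divisible index triples at scales `X_i`. [folklore] -/
theorem re_parityTernarySum_div {c₁ c₂ : ℤ → ℂ} (h₁ : ∀ v : ℝ, (profileFn c₁ v).im = 0)
    (h₂ : ∀ v : ℝ, (profileFn c₂ v).im = 0) {y p : ℕ} (hp : Odd p) (hps : p ∈ Nat.smoothNumbers (y + 1))
    (σ : ℤ) (d₁ d₂ : ℕ) (X₁ X₂ X₃ : ℝ) (c₃ : ℤ → ℂ) :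
    (parityTernarySum y σ d₁ d₂ (X₁ / p) (X₂ / p) (X₃ / p) c₁ c₂ c₃).re =
      ∑ t ∈ ((Nat.smoothNumbersUpTo ⌊X₁⌋₊ (y + 1)).filter (fun n => Odd n)) ×ˢ
        (((Nat.smoothNumbersUpTo ⌊X₂⌋₊ (y + 1)).filter (fun n => Odd n)) ×ˢ
          Nat.smoothNumbersUpTo ⌊X₃⌋₊ (y + 1)),
        if p ∣ t.1 ∧ p ∣ t.2.1 ∧ p ∣ t.2.2 then
          (if (d₁ * t.1 : ℤ) + σ * (d₂ * t.2.1) = t.2.2 then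
            (profileFn c₁ ((t.1 : ℝ) / X₁)).re * (profileFn c₂ ((t.2.1 : ℝ) / X₂)).re *
              (profileFn c₃ ((t.2.2 : ℝ) / X₃)).re
          else 0)
        else 0 := by
  rw [parityTernarySum_div_eq hp hps, Complex.re_sum]
  refine Finset.sum_congr rfl fun t _ => ?_
  split_ifs
  · exact re_mul_mul_conj (h₁ _) (h₂ _) _
  · exact Complex.zero_re
  · exact Complex.zero_re

/-- The odd primes `3 ≤ p ≤ y` are odd and `y`-friable. [folklore] -/
theorem odd_and_smooth_of_mem {y p : ℕ} (hp : p ∈ (Finset.range (y + 1)).filter (fun p => p.Prime ∧ 3 ≤ p)) :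
    Odd p ∧ p ∈ Nat.smoothNumbers (y + 1) := by
  simp only [Finset.mem_filter, Finset.mem_range] at hp
  obtain ⟨hpy, hpp, hp3⟩ := hp
  exact ⟨hpp.odd_of_ne_two (by omega),
    Nat.mem_smoothNumbers'.2 fun q hq hqp => (Nat.le_of_dvd hpp.pos hqp).trans_lt hpy⟩

/-! ### The pointwise Bonferroni inequality and the counting -/

/-- The equation `d m − a = b` read in `ℤ` (the `σ = −1`, `d₂ = 1` instance of the ternary equation) as facts in `ℕ`.
[folklore] -/
theorem nat_of_eqn {d m a b : ℕ} (h : (d : ℤ) * (m : ℤ) + (-1) * (((1 : ℕ) : ℤ) * (a : ℤ)) = (b : ℤ)) :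
    a ≤ d * m ∧ d * m - a = b := by
  have h' : ((d * m : ℕ) : ℤ) = a + b := by
    push_cast at h ⊢
    linear_combination h
  generalize d * m = c at h' ⊢
  omega

/-- ABSTRACT POINTWISE BONFERRONI: for a weight `0 ≤ g ≤ 1_R` and events with "`E` and not `C` ⟹ some `D p` happens",
`1_E g − Σ_p 1_{D p} 1_E g ≤ 1_{E ∧ C ∧ R}`. [folklore] -/
theorem ite_sub_sum_le {ι : Type*} {P : Finset ι} {D : ι → Prop} [DecidablePred D] {E C R : Prop} [Decidable E]
    [Decidable C] [Decidable R] {g : ℝ} (hg0 : 0 ≤ g) (hgR : g ≤ if R then 1 else 0)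
    (hC : E → ¬C → ∃ p ∈ P, D p) :
    (if E then g else 0) - ∑ p ∈ P, (if D p then (if E then g else 0) else 0) ≤
      if E ∧ C ∧ R then 1 else 0 := by
  by_cases hE : E
  · have hs0 : ∀ p ∈ P, 0 ≤ (if D p then g else 0) := fun p _ => by split_ifs; exacts [hg0, le_rfl]
    simp only [hE, if_true, true_and]
    by_cases hc : C
    · simp only [hc, true_and]
      linarith [Finset.sum_nonneg hs0]
    · obtain ⟨p, hpP, hD⟩ := hC hE hc
      have h1 : g ≤ ∑ p ∈ P, (if D p then g else 0) :=
        calc g = (if D p then g else 0) := by rw [if_pos hD]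
          _ ≤ _ := Finset.single_le_sum hs0 hpP
      simp only [hc, false_and, if_false]
      linarith
  · simp [hE]

/-- POINTWISE BONFERRONI for `FC`: at an index triple `(m, a, b)` with `m` odd `y`-friable, the real weight
`1_E g(m,a,b) · (1 − Σ_{3 ≤ p ≤ y prime} 1_{p ∣ m, p ∣ a, p ∣ b})` is at most the indicator of
"`E ∧ gcd(m, a) = 1 ∧ 2M < m ≤ 4M ∧ X < a ∧ 2a ≤ 3X`" (`X = 2^N M`): a common prime factor of `m, a` is odd, `≤ y` and
divides `b = 2^N m − a`; and `g ≤ 1_{m/4M ∈ (1/2,1]} · 1_{a/2X ∈ (1/2,3/4]} · 1`. [folklore] -/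
theorem pointwise_FC {N M y : ℕ} {c₁ c₂ c₃ : ℤ → ℂ}
    (h₁ : ∀ v : ℝ, (profileFn c₁ v).im = 0 ∧ 0 ≤ (profileFn c₁ v).re ∧
      (profileFn c₁ v).re ≤ (if v ∈ Set.Ioc (1 / 2 : ℝ) 1 then 1 else 0))
    (h₂ : ∀ v : ℝ, (profileFn c₂ v).im = 0 ∧ 0 ≤ (profileFn c₂ v).re ∧
      (profileFn c₂ v).re ≤ (if v ∈ Set.Ioc (1 / 2 : ℝ) (3 / 4) then 1 else 0))
    (h₃ : ∀ v : ℝ, (profileFn c₃ v).im = 0 ∧ 0 ≤ (profileFn c₃ v).re ∧ (profileFn c₃ v).re ≤ 1)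
    {m a b : ℕ} (hms : m ∈ Nat.smoothNumbers (y + 1)) (hmo : Odd m) :
    (if ((2 ^ N : ℕ) : ℤ) * (m : ℤ) + (-1) * (((1 : ℕ) : ℤ) * (a : ℤ)) = (b : ℤ) then
        (profileFn c₁ ((m : ℝ) / (4 * M))).re * (profileFn c₂ ((a : ℝ) / (2 * (2 ^ N * M)))).re *
          (profileFn c₃ ((b : ℝ) / (4 * (2 ^ N * M)))).re else 0) -
      ∑ p ∈ (Finset.range (y + 1)).filter (fun p => p.Prime ∧ 3 ≤ p),
        (if p ∣ m ∧ p ∣ a ∧ p ∣ b then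
          (if ((2 ^ N : ℕ) : ℤ) * (m : ℤ) + (-1) * (((1 : ℕ) : ℤ) * (a : ℤ)) = (b : ℤ) then
            (profileFn c₁ ((m : ℝ) / (4 * M))).re * (profileFn c₂ ((a : ℝ) / (2 * (2 ^ N * M)))).re *
              (profileFn c₃ ((b : ℝ) / (4 * (2 ^ N * M)))).re else 0) else 0) ≤
      if ((2 ^ N : ℕ) : ℤ) * (m : ℤ) + (-1) * (((1 : ℕ) : ℤ) * (a : ℤ)) = (b : ℤ) ∧ Nat.Coprime m a ∧
          (2 * M < m ∧ m ≤ 4 * M ∧ 2 ^ N * M < a ∧ 2 * a ≤ 3 * (2 ^ N * M)) then (1 : ℝ) else 0 := by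
  obtain ⟨-, h1n, h1i⟩ := h₁ ((m : ℝ) / (4 * M))
  obtain ⟨-, h2n, h2i⟩ := h₂ ((a : ℝ) / (2 * (2 ^ N * M)))
  obtain ⟨-, h3n, h3i⟩ := h₃ ((b : ℝ) / (4 * (2 ^ N * M)))
  refine ite_sub_sum_le (mul_nonneg (mul_nonneg h1n h2n) h3n) ?_ ?_
  · -- the weight is at most the indicator of the ranges
    have hkey : (m : ℝ) / (4 * M) ∈ Set.Ioc (1 / 2 : ℝ) 1 → (a : ℝ) / (2 * (2 ^ N * M)) ∈ Set.Ioc (1 / 2 : ℝ) (3 / 4) →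
        2 * M < m ∧ m ≤ 4 * M ∧ 2 ^ N * M < a ∧ 2 * a ≤ 3 * (2 ^ N * M) := by
      intro hI₁ hI₂
      have hM : (0 : ℝ) < 4 * M :=
        lt_of_le_of_ne (by positivity) fun h => by have h' := hI₁.1; rw [← h, div_zero] at h'; norm_num at h'
      have hX : (0 : ℝ) < 2 * (2 ^ N * M) :=
        lt_of_le_of_ne (by positivity) fun h => by have h' := hI₂.1; rw [← h, div_zero] at h'; norm_num at h'
      rw [Set.mem_Ioc, lt_div_iff₀ hM, div_le_iff₀ hM] at hI₁
      rw [Set.mem_Ioc, lt_div_iff₀ hX, div_le_iff₀ hX] at hI₂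
      exact ⟨by exact_mod_cast (by linarith [hI₁.1] : (2 : ℝ) * M < m),
        by exact_mod_cast (by linarith [hI₁.2] : (m : ℝ) ≤ 4 * M),
        by exact_mod_cast (by linarith [hI₂.1] : (2 : ℝ) ^ N * M < a),
        by exact_mod_cast (by linarith [hI₂.2] : (2 : ℝ) * a ≤ 3 * (2 ^ N * M))⟩
    have hg : (profileFn c₁ ((m : ℝ) / (4 * M))).re * (profileFn c₂ ((a : ℝ) / (2 * (2 ^ N * M)))).re *
          (profileFn c₃ ((b : ℝ) / (4 * (2 ^ N * M)))).re ≤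
        (if (m : ℝ) / (4 * M) ∈ Set.Ioc (1 / 2 : ℝ) 1 then 1 else 0) *
          (if (a : ℝ) / (2 * (2 ^ N * M)) ∈ Set.Ioc (1 / 2 : ℝ) (3 / 4) then 1 else 0) :=
      calc _ ≤ (profileFn c₁ ((m : ℝ) / (4 * M))).re * (profileFn c₂ ((a : ℝ) / (2 * (2 ^ N * M)))).re * 1 :=
            mul_le_mul_of_nonneg_left h3i (mul_nonneg h1n h2n)
        _ ≤ _ := by
            rw [mul_one]
            exact mul_le_mul h1i h2i h2n (by positivity)
    refine hg.trans ?_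
    by_cases hI₁ : (m : ℝ) / (4 * M) ∈ Set.Ioc (1 / 2 : ℝ) 1
    · by_cases hI₂ : (a : ℝ) / (2 * (2 ^ N * M)) ∈ Set.Ioc (1 / 2 : ℝ) (3 / 4)
      · rw [if_pos hI₁, if_pos hI₂, if_pos (hkey hI₁ hI₂), one_mul]
      · rw [if_neg hI₂, mul_zero]; positivity
    · rw [if_neg hI₁, zero_mul]; positivity
  · -- a common prime factor of `m` and `a` is an odd prime `≤ y` dividing `b`
    intro hE hc
    obtain ⟨p, hp, hpm, hpa⟩ := Nat.Prime.not_coprime_iff_dvd.1 hc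
    obtain ⟨-, hb⟩ := nat_of_eqn hE
    have h2 := hp.two_le
    have hp2 : p ≠ 2 := fun h => hmo.not_two_dvd_nat (h ▸ hpm)
    refine ⟨p, Finset.mem_filter.2 ⟨Finset.mem_range.2 (Nat.mem_smoothNumbers'.1 hms p hp hpm), hp, by omega⟩,
      hpm, hpa, ?_⟩
    rw [← hb]
    exact Nat.dvd_sub (Dvd.dvd.mul_left hpm _) hpa

/-- COUNTING: index triples `(m, a, b)` (`m, a` odd `y`-friable, `b` `y`-friable) with `2^N m − a = b`, `gcd(m, a) = 1`,
`2M < m ≤ 4M`, `X < a`, `2a ≤ 3X` inject by `(m, a, b) ↦ (m, a)` into the pair set counting `FCfam N M y`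
(`card_FCfam`). [folklore] -/
theorem card_filter_le_card_FCfam (N M y : ℕ) (T : Finset (ℕ × ℕ × ℕ))
    (hT : ∀ t ∈ T, t.1 ∈ Nat.smoothNumbers (y + 1) ∧ Odd t.1 ∧ t.2.1 ∈ Nat.smoothNumbers (y + 1) ∧ Odd t.2.1 ∧
      t.2.2 ∈ Nat.smoothNumbers (y + 1)) :
    (T.filter (fun t => ((2 ^ N : ℕ) : ℤ) * (t.1 : ℤ) + (-1) * (((1 : ℕ) : ℤ) * (t.2.1 : ℤ)) = (t.2.2 : ℤ) ∧
        Nat.Coprime t.1 t.2.1 ∧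
          (2 * M < t.1 ∧ t.1 ≤ 4 * M ∧ 2 ^ N * M < t.2.1 ∧ 2 * t.2.1 ≤ 3 * (2 ^ N * M)))).card ≤
      (FCfam N M y).card := by
  rw [card_FCfam]
  refine Finset.card_le_card_of_injOn (fun t => (t.1, t.2.1)) ?_ ?_
  · rintro ⟨m, a, b⟩ ht
    simp only [Finset.mem_coe, Finset.mem_filter] at ht
    obtain ⟨ht, hE, hcop, h1, h2, h3, h4⟩ := ht
    obtain ⟨hms, hmo, has, hao, hbs⟩ := hT _ ht
    dsimp only at hms hmo has hao hbs
    obtain ⟨-, hb⟩ := nat_of_eqn hE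
    simp only [Finset.mem_coe, friableIoc, Finset.mem_filter, Finset.mem_product, Finset.mem_Ioc]
    refine ⟨⟨⟨⟨⟨h1, h2⟩, hms⟩, hmo⟩, ⟨h3, (Nat.le_div_iff_mul_le two_pos).2 (by rw [mul_comm]; exact h4)⟩, has⟩,
      Nat.Coprime.mul_right (Nat.coprime_two_right.2 hao) hcop.symm, ?_⟩
    rw [hb]
    exact hbs
  · rintro ⟨m, a, b⟩ ht ⟨m', a', b'⟩ ht' h
    simp only [Prod.mk.injEq] at h
    obtain ⟨rfl, rfl⟩ := h
    simp only [Finset.mem_coe, Finset.mem_filter] at ht ht'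
    rw [← (nat_of_eqn ht.2.1).2, ← (nat_of_eqn ht'.2.1).2]

/-- The triple sum of the Bonferroni-corrected real weights over any set of index triples with `m, a` odd `y`-friable,
`b` `y`-friable is at most `#FCfam N M y` (`pointwise_FC` termwise, then `card_filter_le_card_FCfam`). [folklore] -/
theorem sum_le_card_FCfam {N M y : ℕ} {c₁ c₂ c₃ : ℤ → ℂ}
    (h₁ : ∀ v : ℝ, (profileFn c₁ v).im = 0 ∧ 0 ≤ (profileFn c₁ v).re ∧
      (profileFn c₁ v).re ≤ (if v ∈ Set.Ioc (1 / 2 : ℝ) 1 then 1 else 0))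
    (h₂ : ∀ v : ℝ, (profileFn c₂ v).im = 0 ∧ 0 ≤ (profileFn c₂ v).re ∧
      (profileFn c₂ v).re ≤ (if v ∈ Set.Ioc (1 / 2 : ℝ) (3 / 4) then 1 else 0))
    (h₃ : ∀ v : ℝ, (profileFn c₃ v).im = 0 ∧ 0 ≤ (profileFn c₃ v).re ∧ (profileFn c₃ v).re ≤ 1)
    {T : Finset (ℕ × ℕ × ℕ)}
    (hT : ∀ t ∈ T, t.1 ∈ Nat.smoothNumbers (y + 1) ∧ Odd t.1 ∧ t.2.1 ∈ Nat.smoothNumbers (y + 1) ∧ Odd t.2.1 ∧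
      t.2.2 ∈ Nat.smoothNumbers (y + 1)) :
    ∑ t ∈ T, ((if ((2 ^ N : ℕ) : ℤ) * (t.1 : ℤ) + (-1) * (((1 : ℕ) : ℤ) * (t.2.1 : ℤ)) = (t.2.2 : ℤ) then
        (profileFn c₁ ((t.1 : ℝ) / (4 * M))).re * (profileFn c₂ ((t.2.1 : ℝ) / (2 * (2 ^ N * M)))).re *
          (profileFn c₃ ((t.2.2 : ℝ) / (4 * (2 ^ N * M)))).re else 0) -
      ∑ p ∈ (Finset.range (y + 1)).filter (fun p => p.Prime ∧ 3 ≤ p),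
        (if p ∣ t.1 ∧ p ∣ t.2.1 ∧ p ∣ t.2.2 then
          (if ((2 ^ N : ℕ) : ℤ) * (t.1 : ℤ) + (-1) * (((1 : ℕ) : ℤ) * (t.2.1 : ℤ)) = (t.2.2 : ℤ) then
            (profileFn c₁ ((t.1 : ℝ) / (4 * M))).re * (profileFn c₂ ((t.2.1 : ℝ) / (2 * (2 ^ N * M)))).re *
              (profileFn c₃ ((t.2.2 : ℝ) / (4 * (2 ^ N * M)))).re else 0) else 0)) ≤
      ((FCfam N M y).card : ℝ) := by
  refine (Finset.sum_le_sum fun t ht => pointwise_FC h₁ h₂ h₃ (hT t ht).1 (hT t ht).2.1).trans ?_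
  rw [Finset.sum_boole]
  exact_mod_cast card_filter_le_card_FCfam N M y T hT

end BonferroniFCBook

open BonferroniFCBook

/-- **Registered stub `stub_cardFC_ge_bonferroni`** (line `grh-friable-cell-resolution` of crux stmt-ABC-14354, wave 7):
for real nonnegative profiles `p₁ ≤ 1_{(1/2,1]}`, `p₂ ≤ 1_{(1/2,3/4]}`, `p₃ ≤ 1`, the smooth-profile parity ternary count
`W = parityTernarySum y (−1) 2^N 1 (4M) (2X) (4X)` (`X = 2^N M`) of `y`-friable solutions of `2^N m − a = b` minus its
`p`-sublattice counts `W_p = W(4M/p, 2X/p, 4X/p)` over the odd primes `p ≤ y` lower-bounds `#FCfam N M y`: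
`Re W − Σ_p Re W_p ≤ #FCfam N M y`.  Assembled from `re_parityTernarySum`, the sublattice identity
`re_parityTernarySum_div`, and `sum_le_card_FCfam` (pointwise Bonferroni + counting); `2 ≤ y` is not used. [folklore] -/
theorem stub_cardFC_ge_bonferroni : ∀ (N M y : ℕ) (c₁ c₂ c₃ : ℤ → ℂ), 2 ≤ y → (∀ v : ℝ, (Literature.NumberTheory.Sieve.SmoothArcs.profileFn c₁ v).im = 0 ∧ 0 ≤ (Literature.NumberTheory.Sieve.SmoothArcs.profileFn c₁ v).re ∧ (Literature.NumberTheory.Sieve.SmoothArcs.profileFn c₁ v).re ≤ (if v ∈ Set.Ioc (1 / 2 : ℝ) 1 then 1 else 0)) → (∀ v : ℝ, (Literature.NumberTheory.Sieve.SmoothArcs.profileFn c₂ v).im = 0 ∧ 0 ≤ (Literature.NumberTheory.Sieve.SmoothArcs.profileFn c₂ v).re ∧ (Literature.NumberTheory.Sieve.SmoothArcs.profileFn c₂ v).re ≤ (if v ∈ Set.Ioc (1 / 2 : ℝ) (3 / 4) then 1 else 0)) → (∀ v : ℝ, (Literature.NumberTheory.Sieve.SmoothArcs.profileFn c₃ v).im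 = 0 ∧ 0 ≤ (Literature.NumberTheory.Sieve.SmoothArcs.profileFn c₃ v).re ∧ (Literature.NumberTheory.Sieve.SmoothArcs.profileFn c₃ v).re ≤ 1) → (Literature.NumberTheory.Sieve.SmoothArcs.parityTernarySum y (-1) (2 ^ N) 1 (4 * M) (2 * (2 ^ N * M)) (4 * (2 ^ N * M)) c₁ c₂ c₃).re - ∑ p ∈ (Finset.range (y + 1)).filter (fun p => p.Prime ∧ 3 ≤ p), (Literature.NumberTheory.Sieve.SmoothArcs.parityTernarySum y (-1) (2 ^ N) 1 ((4 * M : ℝ) / p) ((2 * (2 ^ N * M) : ℝ) / p) ((4 * (2 ^ N * M) : ℝ) / p) c₁ c₂ c₃).re ≤ ((FCfam N M y).card : ℝ) := by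
  intro N M y c₁ c₂ c₃ _ h₁ h₂ h₃
  have hi₁ : ∀ v : ℝ, (profileFn c₁ v).im = 0 := fun v => (h₁ v).1
  have hi₂ : ∀ v : ℝ, (profileFn c₂ v).im = 0 := fun v => (h₂ v).1
  rw [re_parityTernarySum hi₁ hi₂,
    Finset.sum_congr rfl fun p (hp : p ∈ (Finset.range (y + 1)).filter (fun p => p.Prime ∧ 3 ≤ p)) =>
      re_parityTernarySum_div hi₁ hi₂ (odd_and_smooth_of_mem hp).1 (odd_and_smooth_of_mem hp).2 (-1) (2 ^ N) 1
        (4 * M : ℝ) (2 * (2 ^ N * M) : ℝ) (4 * (2 ^ N * M) : ℝ) c₃,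
    Finset.sum_comm, ← Finset.sum_sub_distrib]
  refine sum_le_card_FCfam h₁ h₂ h₃ fun t ht => ?_
  simp only [Finset.mem_product, Finset.mem_filter, Nat.mem_smoothNumbersUpTo] at ht
  exact ⟨ht.1.1.2, ht.1.2, ht.2.1.1.2, ht.2.1.2, ht.2.2.2⟩

end Summit.ABC.ABC.Theorems.TameLocalReceptacle

end
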